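import Literature.AlgebraicGeometry.Resolution.QuadraticTransformsRegular
import Literature.AlgebraicGeometry.Resolution.ModelTransport
import Literature.AlgebraicGeometry.Resolution.ExcellentRingsEssFiniteType
import Literature.Algebra.Polynomial.QDilationCongruence
import Mathlib.RingTheory.LocalRing.ResidueField.Basic
import HarnessLib

/-!
# Cossart–Piltant's frame after blowing up the closed point: the chart of the centre of `μ`
# (arXiv v1 Prop. 2.7 and Prop. 2.10, valuative form)

Topic: `Literature/AlgebraicGeometry/Resolution`. PROOF side of `CossartPiltant2019Local`
(`ArithmeticalThreefoldsLocal.lean`; Cossart–Piltant 2019, journal Thm. 1.5 = arXiv v1 Thm. 1.4),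
continuing `ArithmeticalThreefoldsLocalReduction.lean`, which reduces the local theorem to the
NORMAL FORM `h ≡ X^p mod 𝔪_S[X]` with `f_i ∈ 𝔪_S^i` (the closed point `x = (𝔪_S, X)` lies in
`Sing_p 𝒳`, i.e. `δ(x) ≥ 1`). The printed proof then proceeds by local Hironaka-permissible
blowing ups along the valuation `μ` (v1 §2.2), the first of which may be taken at the closed
point `x` itself, and re-establishes its standing frame `(S', h', u', E')` at the centre `x'`
of `μ` on the blown-up hypersurface — arXiv v1 **Prop. 2.7** (p. 14):

> "Let `π : 𝒳' → 𝒳` be a Hironaka-permissible blowing up w.r.t. `E` at `x ∈ 𝒳` … For every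
> `s' ∈ σ⁻¹(s)`, `S' := 𝒪_{𝒮',s'}`, there exists `h' ∈ S'[X']` unitary of degree `m` such that
> `𝒳'_{s'} = Spec(S'[X']/(h'))`. … Since `δ(y) ≥ 1`, the point at infinity `(1:0:⋯:0)` does
> not belong to `𝒳'` … We take `X' := Z/u_{j₀}` and `h' := u_{j₀}^{-m} h(Z) = X'^m +
> u_{j₀}^{-1} f_{1,Z} X'^{m-1} + ⋯ + u_{j₀}^{-m} f_{m,Z}`."

and **Prop. 2.10** (p. 15): "for every `s' ∈ σ⁻¹(s)`, `𝒳'_{s'}` satisfies again (G)" — for the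
centre the closed point (`J = {1, …, n}`, `W = {s}`, `σ` the blowing up of `Spec S` at `𝔪_S`).

Everything is phrased VALUATIVELY, inside the field `L ∋ x` carrying the valuation ring
`O = 𝒪_μ`, in the language of the tree's local blowing ups (`LocalBlowup.lean`) and quadratic
transforms along a valuation (`QuadraticTransforms.lean`, `QuadraticTransformsRegular.lean`):
the base `S` is a local subring `R ⊆ O` dominated by `O`, the new base is the quadratic
transform `R₁ = (R[𝔪_R/c])_{𝔪_O ∩ R[𝔪_R/c]}` of `R` along `O` (`c ∈ 𝔪_R` of minimal value
= the chart `u_{j₀} ≠ 0` containing the centre `s'` of `μ`; `S' = 𝒪_{𝒮',s'} = R₁`), the new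
generator is `x₁ = x/c` (`X' := Z/u_{j₀}`) and the new equation is `h₁ = c^{-m} h(cX)`. PROVED:

* `valuation_le_pow_of_mem_pow`, `valuation_root_le_of_coeff_mem_pow`,
  `inv_mul_root_mem_of_coeff_mem_pow` — **the point at infinity is not on `𝒳'`**: if
  `f_i ∈ I^i` and `c` has minimal value on `I`, every root `x ∈ L` of `h` has `μ(x) ≥ μ(c)`,
  i.e. `x/c ∈ O` (the `X`-chart is never needed, `η' : 𝒳' → 𝒮'` stays finite over the
  centre of `μ`);
* `div_pow_mem_blowupRing` — `f/c^i ∈ R[𝔪_R/c]` for `f ∈ 𝔪_R^i` ("`h' ∈ S'[X']` follows from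
  the last statement in proposition (Deltaalg)", i.e. from `f_{i,Z} ∈ 𝔪_S^i`);
* `coeff_scaleRoots_map_inv`, `exists_transform` — **the transformed equation**: for
  `R[𝔪_R/c] ≤ R₁`, there is a monic `h₁ ∈ R₁[X]` of degree `m` with `c^{m-i} · (h₁)_i = (h)_i`,
  mapping to `(h ↦ L[X]).scaleRoots c⁻¹` (coefficients `f_i/c^i`), with root `x₁ = c⁻¹x`;
  `transform_coeff_eq_zero` — case (i) (`f_1 = ⋯ = f_{m-1} = 0`) is preserved;
  `irreducible_scaleRoots_iff`, `irreducible_transform_map_iff` — irreducibility over a field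
  `K` through which `R` and `R₁` map to `L` (their common fraction field) is preserved;
  `adjoin_inv_mul_eq` — `K(x₁) = K(x)` (so `L = K(x₁)`);
* `exists_max_valuation_maximalIdeal`, `isQuadraticTransformAlong_of_max` — the chart of the
  centre: a nonzero `c ∈ 𝔪_R` of minimal value exists (Noetherian `R`, `𝔪_R ≠ 0`) and
  `R₁ := locAtCentre (blowupRing R c) O` IS the quadratic transform of `R` along `O`; hence
  (tree) `R ≤ R₁ ≤ O`, `R₁` local, dominated by `O`, and REGULAR if `R` is
  (`IsQuadraticTransformAlong.isRegularLocalRing_of_isRegularLocalRing`, Abhyankar);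
  `ringHom_apply_eq_self_of_mem_locAtCentre_blowupRing` — a ring endomorphism of `L` fixing `R`
  fixes `R₁`; `charP_residueField_of_subringDominates` — `R₁` has the residue characteristic of
  `R`; `isExcellentRing_locAtCentre_closure` — `R₁` is excellent if `R` is (essentially of
  finite type, `ExcellentRingsEssFiniteType.lean`);
* `coeff_zero_mem_maximalIdeal_of_aeval_comp_eq_zero`, `adjoin_transform_stable_of_stable` —
  **(G) is preserved (Prop. 2.10)**: if `h ≡ X^m mod 𝔪_R` (`m ≥ 1`), `(h) = ker(g ↦ g(x))` on
  `R[X]`, and a ring endomorphism `σ` of `L` fixing `R₁` maps `R[x]` into itself, then `σ`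
  maps `R₁[x₁]` into itself — because `σx = r(x)` with `deg r < m` forces `r(0) ∈ 𝔪_R`
  (reduce `h ∣ h∘r` modulo `𝔪_R`: `X^m ∣ r̄^m`), so that
  `σx₁ = r(0)/c + Σ_{k≥1} r_k c^{k-1} x₁^k ∈ R₁[x₁]`;
* `exists_model_of_isLocalBlowup_model`, `exists_model_of_quadraticTransform_model` — **back to
  the original base**: a finitely generated model `R₁[x₁][t₁] ⊆ O` regular at the centre of
  `O`, over a local blowing up `R₁ = (R[b])_{𝔪_O ∩ R[b]}` of `R` and containing `x` (e.g.
  `x = c·x₁`), yields a finitely generated model `R[x][t] ⊆ O` regular at the centre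
  (`t = b ∪ {x₁} ∪ t₁`; sandwich `R[x][t] ⊆ R₁[x₁][t₁] ⊆ R[x][t]_{centre}`,
  `ModelTransport.lean`) — the
  weak local-uniformization conclusion of `CossartPiltant2019Local` descends along the local
  blowing up.

Not treated here: centres of positive dimension (`J ⊊ {1, …, n}`: monoidal transforms along
`(Z, u_J)`), the transformation rule for the characteristic polyhedron (v1 Prop. 2.6), the
boundary `E'`, and the dimension count `dim R₁ = dim R` at residually algebraic valuations
(`LocalModels.lean`, `DimensionFormula.lean`). Everything is PROVED; no definitions and no
named facts are introduced.

## Sources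

* V. Cossart, O. Piltant, J. Algebra 529 (2019) 268–535 = arXiv:1412.0868: arXiv v1 Prop. 2.7
  and its proof, (2.10) (p. 14); Prop. 2.10 (p. 15); §2.2 "local Hironaka-permissible blowing
  up" (p. 14). [CossartPiltant2019]
* S. S. Abhyankar, *Ramification theoretic methods in algebraic geometry* (1959), Lemma 3.20 —
  through `QuadraticTransformsRegular.lean`. [Abhyankar1959]
* J. Novacoski, M. Spivakovsky, arXiv:1204.4751, Defs. 2.8, 2.11 — through `LocalBlowup.lean`.
  [NovacoskiSpivakovsky2014]
-/

noncomputable section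

open IsLocalRing Polynomial

namespace Literature.AlgebraicGeometry.Resolution

universe u

/-! ## The point at infinity is not on the strict transform: `μ(x) ≥ μ(c)` -/

section RootValue

variable {A L : Type*} [CommRing A] [Field L] [Algebra A L] (O : ValuationSubring L)

/-- If every element of the ideal `I` has value `≤ γ` (and `A` maps into `O`), every element
of `I^k` has value `≤ γ^k`. [folklore] -/
theorem valuation_le_pow_of_mem_pow (hAO : ∀ a : A, algebraMap A L a ∈ O) {I : Ideal A}
    {γ : O.ValueGroup} (hI : ∀ a ∈ I, O.valuation (algebraMap A L a) ≤ γ) :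
    ∀ (k : ℕ) {a : A}, a ∈ I ^ k → O.valuation (algebraMap A L a) ≤ γ ^ k := by
  intro k
  induction k with
  | zero =>
    intro a _
    rw [pow_zero]
    exact (O.valuation_le_one_iff _).mpr (hAO a)
  | succ k ih =>
    intro a ha
    rw [pow_succ] at ha
    refine Submodule.mul_induction_on ha (fun m hm n hn => ?_) (fun y z hy hz => ?_)
    · rw [map_mul, map_mul, pow_succ]
      exact mul_le_mul' (ih hm) (hI n hn)
    · rw [map_add]
      exact (Valuation.map_add _ _ _).trans (max_le hy hz)

/-- **The point at infinity is not on the strict transform** (Cossart–Piltant, proof of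
Prop. 2.7: "Since `δ(y) ≥ 1`, the point at infinity `(1:0:⋯:0)` does not belong to `𝒳'`").
Let `h = X^m + a_{m-1}X^{m-1} + ⋯ + a_0 ∈ A[X]` be monic with `a_i ∈ I^{m-i}` for an ideal `I`
(for `I = 𝔪_S` and `m = p`: `f_{i,X} ∈ 𝔪_S^i`, i.e. `δ(x) ≥ 1`, the normal form of
`ArithmeticalThreefoldsLocalReduction.lean`), let `O` be a valuation ring of a field `L ⊇ A`, and
let `c ∈ A` have minimal value on `I` (`μ(a) ≥ μ(c)` for `a ∈ I`; multiplicatively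
`v(a) ≤ v(c)`). Then every root `x ∈ L` of `h` satisfies `μ(x) ≥ μ(c)`, i.e. `v(x) ≤ v(c)`:
otherwise `v(a_i x^i) ≤ v(c)^{m-i} v(x)^i < v(x)^m` for `i < m`, contradicting `x^m = -Σ a_i x^i`.
So `x/c ∈ O`: the centre of `μ` on the blown-up hypersurface lies in the chart `c ≠ 0` of the
blowing up of the base, over which the projection `η'` remains finite.
[cite: CossartPiltant2019, proof of Prop. 2.7 (arXiv v1, p. 14)] -/
theorem valuation_root_le_of_coeff_mem_pow (hAO : ∀ a : A, algebraMap A L a ∈ O) {I : Ideal A}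
    {c : A} (hc : ∀ a ∈ I, O.valuation (algebraMap A L a) ≤ O.valuation (algebraMap A L c))
    {h : A[X]} (hmon : h.Monic)
    (hcoef : ∀ i < h.natDegree, h.coeff i ∈ I ^ (h.natDegree - i)) {x : L} (hx : aeval x h = 0) :
    O.valuation x ≤ O.valuation (algebraMap A L c) := by
  by_contra hlt
  rw [not_le] at hlt
  set m := h.natDegree with hm
  set γ := O.valuation (algebraMap A L c) with hγ
  have hx0 : O.valuation x ≠ 0 := ne_of_gt (lt_of_le_of_lt zero_le hlt)
  -- `x^m = -Σ_{i<m} a_i x^i`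
  have hsum : x ^ m = -∑ i ∈ Finset.range m, algebraMap A L (h.coeff i) * x ^ i := by
    have h1 := hx
    rw [aeval_eq_sum_range, Finset.sum_range_succ] at h1
    simp only [Algebra.smul_def] at h1
    rw [show h.coeff m = 1 from hmon, map_one, one_mul] at h1
    linear_combination h1
  -- every term on the right has value `< v(x)^m`
  have hterm : ∀ i ∈ Finset.range m,
      O.valuation (algebraMap A L (h.coeff i) * x ^ i) < O.valuation x ^ m := by
    intro i hi
    rw [Finset.mem_range] at hi
    rw [map_mul, map_pow]
    have hci : O.valuation (algebraMap A L (h.coeff i)) ≤ γ ^ (m - i) :=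
      valuation_le_pow_of_mem_pow O hAO hc (m - i) (hcoef i hi)
    have hpow : γ ^ (m - i) < O.valuation x ^ (m - i) :=
      pow_lt_pow_left₀ hlt zero_le (Nat.sub_ne_zero_of_lt hi)
    calc O.valuation (algebraMap A L (h.coeff i)) * O.valuation x ^ i
        ≤ γ ^ (m - i) * O.valuation x ^ i := mul_le_mul_left hci _
      _ < O.valuation x ^ (m - i) * O.valuation x ^ i :=
          mul_lt_mul_of_pos_right hpow (pow_pos (zero_lt_iff.mpr hx0) _)
      _ = O.valuation x ^ m := by rw [← pow_add, Nat.sub_add_cancel hi.le]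
  have hlt' : O.valuation (x ^ m) < O.valuation x ^ m := by
    rw [hsum, Valuation.map_neg]
    exact Valuation.map_sum_lt _ (pow_ne_zero _ hx0) hterm
  rw [map_pow] at hlt'
  exact lt_irrefl _ hlt'

/-- In particular `x/c` lies in the valuation ring. [cite: CossartPiltant2019, proof of Prop. 2.7 (arXiv v1, p. 14)] -/
theorem inv_mul_root_mem_of_coeff_mem_pow (hAO : ∀ a : A, algebraMap A L a ∈ O) {I : Ideal A}
    {c : A} (hc : ∀ a ∈ I, O.valuation (algebraMap A L a) ≤ O.valuation (algebraMap A L c))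
    (hc0 : algebraMap A L c ≠ 0) {h : A[X]} (hmon : h.Monic)
    (hcoef : ∀ i < h.natDegree, h.coeff i ∈ I ^ (h.natDegree - i)) {x : L} (hx : aeval x h = 0) :
    (algebraMap A L c)⁻¹ * x ∈ O := by
  rw [← O.valuation_le_one_iff, map_mul, map_inv₀]
  have hv := valuation_root_le_of_coeff_mem_pow O hAO hc hmon hcoef hx
  have hc0' : O.valuation (algebraMap A L c) ≠ 0 := (_root_.map_ne_zero _).mpr hc0
  calc (O.valuation (algebraMap A L c))⁻¹ * O.valuation x
      ≤ (O.valuation (algebraMap A L c))⁻¹ * O.valuation (algebraMap A L c) :=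
        mul_le_mul_right hv _
    _ = 1 := inv_mul_cancel₀ hc0'

end RootValue

/-! ## The transformed equation `h₁ = c^{-m} h(cX)` over the blow-up ring `R[𝔪_R/c]` -/

section Transform

variable {L : Type u} [Field L] {R : Subring L}

/-- `f/c^k ∈ R[𝔪_R/c]` for `f ∈ 𝔪_R^k` — so the coefficients `u_{j₀}^{-i} f_{i,Z}` of the
transformed equation lie in the chart ring as soon as `f_{i,Z} ∈ 𝔪_S^i` ("`h' ∈ S'[X']` follows
from the last statement in proposition (Deltaalg)"). [cite: CossartPiltant2019, proof of Prop. 2.7 (arXiv v1, p. 14)] -/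
theorem div_pow_mem_blowupRing [IsLocalRing R] (c : L) :
    ∀ (k : ℕ) {f : R}, f ∈ maximalIdeal R ^ k → (f : L) / c ^ k ∈ blowupRing R c := by
  intro k
  induction k with
  | zero =>
    intro f _
    rw [pow_zero, div_one]
    exact le_blowupRing R c f.2
  | succ k ih =>
    intro f hf
    rw [pow_succ] at hf
    refine Submodule.mul_induction_on hf (fun m hm n hn => ?_) (fun y z hy hz => ?_)
    · have : ((m * n : R) : L) / c ^ (k + 1) = (m : L) / c ^ k * ((n : L) / c) := by
        rw [Subring.coe_mul, pow_succ, div_mul_div_comm]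
      rw [this]
      exact Subring.mul_mem _ (ih hm) (div_mem_blowupRing c hn)
    · rw [Subring.coe_add, add_div]
      exact Subring.add_mem _ hy hz

variable {c : R}

/-- The coefficients of `(h ↦ L[X]).scaleRoots c⁻¹` are `f_i / c^{m-i}`. [folklore] -/
theorem coeff_scaleRoots_map_inv (h : R[X]) (hmon : h.Monic) (i : ℕ) :
    ((h.map (algebraMap R L)).scaleRoots (c : L)⁻¹).coeff i =
      (h.coeff i : L) / (c : L) ^ (h.natDegree - i) := by
  rw [coeff_scaleRoots, hmon.natDegree_map, coeff_map, inv_pow, div_eq_mul_inv]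
  rfl

/-- **The transformed equation** (Cossart–Piltant, Prop. 2.7, (2.10):
`h' := u_{j₀}^{-m} h(Z) = X'^m + u_{j₀}^{-1} f_{1,Z} X'^{m-1} + ⋯ + u_{j₀}^{-m} f_{m,Z} ∈ S'[X']`,
`X' := Z/u_{j₀}`). Let `R ⊆ L` be a local subring, `c ∈ R` nonzero, `h ∈ R[X]` monic of degree
`m` with `f_i := (h)_{m-i} ∈ 𝔪_R^i`, `x ∈ L` a root, and `R₁ ⊆ L` a subring containing
`R[𝔪_R/c]`. Then there is a monic `h₁ ∈ R₁[X]` of degree `m`, mapping to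
`(h ↦ L[X]).scaleRoots c⁻¹` (coefficients `f_i/c^i`), with `c^{m-i}·(h₁)_i = (h)_i` and root
`x₁ = c⁻¹x`. [cite: CossartPiltant2019, Prop. 2.7, (2.10) (arXiv v1, p. 14)] -/
theorem exists_transform [IsLocalRing R] (hc0 : (c : L) ≠ 0) {h : R[X]} (hmon : h.Monic)
    (hcoef : ∀ i < h.natDegree, h.coeff i ∈ maximalIdeal R ^ (h.natDegree - i))
    {x : L} (hx : aeval x h = 0) {R₁ : Subring L} (hR₁ : blowupRing R (c : L) ≤ R₁) :
    ∃ h₁ : R₁[X], h₁.Monic ∧ h₁.natDegree = h.natDegree ∧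
      h₁.map (algebraMap R₁ L) = (h.map (algebraMap R L)).scaleRoots (c : L)⁻¹ ∧
      (∀ i, (h₁.coeff i : L) * (c : L) ^ (h.natDegree - i) = h.coeff i) ∧
      aeval ((c : L)⁻¹ * x) h₁ = 0 := by
  set g : L[X] := (h.map (algebraMap R L)).scaleRoots (c : L)⁻¹ with hg
  have hgmon : g.Monic := (monic_scaleRoots_iff _).mpr (hmon.map _)
  have hgdeg : g.natDegree = h.natDegree := by
    rw [hg, natDegree_scaleRoots, hmon.natDegree_map]
  -- the coefficients of `g` lie in `R₁`
  have hlift : g ∈ Polynomial.lifts (algebraMap R₁ L) := by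
    rw [lifts_iff_coeff_lifts]
    intro i
    have hi : g.coeff i ∈ R₁ := by
      rw [hg, coeff_scaleRoots_map_inv h hmon i]
      rcases lt_trichotomy i h.natDegree with hlt | heq | hgt
      · exact hR₁ (div_pow_mem_blowupRing (c : L) _ (hcoef i hlt))
      · rw [heq, Nat.sub_self, pow_zero, div_one, show h.coeff h.natDegree = 1 from hmon]
        exact Subring.one_mem _
      · rw [coeff_eq_zero_of_natDegree_lt hgt, Subring.coe_zero, zero_div]
        exact Subring.zero_mem _
    exact ⟨⟨g.coeff i, hi⟩, rfl⟩
  obtain ⟨h₁, hmap, hdeg, hmon₁⟩ := lifts_and_natDegree_eq_and_monic hlift hgmon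
  refine ⟨h₁, hmon₁, hdeg.trans hgdeg, hmap, fun i => ?_, ?_⟩
  · have hci : (h₁.coeff i : L) = g.coeff i := by
      rw [← hmap, coeff_map]; rfl
    rw [hci, hg, coeff_scaleRoots_map_inv h hmon i,
      div_mul_cancel₀ _ (pow_ne_zero _ hc0)]
  · have h1 : aeval ((c : L)⁻¹ * x) h₁ = aeval ((c : L)⁻¹ * x) (h₁.map (algebraMap R₁ L)) := by
      rw [aeval_map_algebraMap]
    rw [h1, hmap, hg]
    have hx' : aeval x (h.map (algebraMap R L)) = 0 := by rwa [aeval_map_algebraMap]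
    have := scaleRoots_aeval_eq_zero (r := (c : L)⁻¹) hx'
    simpa using this

/-- Case (i) is preserved: if `(h)_i = 0` for `0 < i < m` then `(h₁)_i = 0` for `0 < i < m`.
[cite: CossartPiltant2019, Prop. 2.10 (arXiv v1, p. 15)] -/
theorem transform_coeff_eq_zero (hc0 : (c : L) ≠ 0) {h : R[X]} {R₁ : Subring L} {h₁ : R₁[X]}
    (hcoe : ∀ i, (h₁.coeff i : L) * (c : L) ^ (h.natDegree - i) = h.coeff i)
    (hzero : ∀ i, 0 < i → i < h.natDegree → h.coeff i = 0) :
    ∀ i, 0 < i → i < h.natDegree → h₁.coeff i = 0 := by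
  intro i hi0 hi
  have h1 := hcoe i
  rw [hzero i hi0 hi, Subring.coe_zero, mul_eq_zero] at h1
  rcases h1 with h1 | h1
  · exact Subtype.ext h1
  · exact absurd h1 (pow_ne_zero _ hc0)

/-- Scaling the roots by a nonzero element of a field preserves irreducibility (both ways;
`Literature.Algebra.Polynomial.irreducible_scaleRoots` and `scaleRoots` by `s⁻¹`). [folklore] -/
theorem irreducible_scaleRoots_iff {F : Type*} [Field F] (p : F[X]) {s : F} (hs : s ≠ 0) :
    Irreducible (p.scaleRoots s) ↔ Irreducible p := by
  refine ⟨fun h => ?_, fun h => Literature.Algebra.Polynomial.irreducible_scaleRoots h hs⟩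
  have h' := Literature.Algebra.Polynomial.irreducible_scaleRoots h (inv_ne_zero hs)
  rwa [← scaleRoots_mul, mul_inv_cancel₀ hs, scaleRoots_one] at h'

/-- **Irreducibility over the fraction field is preserved.** If `K` is a field mapped into `L`
through which both `R` and `R₁` factor (`ι ∘ φ = (R ⊆ L)`, `ι ∘ φ₁ = (R₁ ⊆ L)`; e.g. `K` the
common fraction field of `R ≤ R₁`), then `h₁ ↦ K[X]` is `(h ↦ K[X]).scaleRoots (φ c)⁻¹`, so one
is irreducible iff the other is. [cite: CossartPiltant2019, Prop. 2.10 (arXiv v1, p. 15)] -/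
theorem irreducible_transform_map_iff {K : Type*} [Field K] (ι : K →+* L) (φ : R →+* K)
    (hφ : ∀ r : R, ι (φ r) = r) {R₁ : Subring L} (φ₁ : R₁ →+* K) (hφ₁ : ∀ r : R₁, ι (φ₁ r) = r)
    (hc0 : (c : L) ≠ 0) {h : R[X]} (hmon : h.Monic) {h₁ : R₁[X]}
    (hmap : h₁.map (algebraMap R₁ L) = (h.map (algebraMap R L)).scaleRoots (c : L)⁻¹) :
    Irreducible (h₁.map φ₁) ↔ Irreducible (h.map φ) := by
  have hιφ : ι.comp φ = algebraMap R L := RingHom.ext fun r => hφ r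
  have hιφ₁ : ι.comp φ₁ = algebraMap R₁ L := RingHom.ext fun r => hφ₁ r
  have hφc : φ c ≠ 0 := fun h0 => hc0 (by rw [← hφ c, h0, map_zero])
  have hlead : ι (h.map φ).leadingCoeff ≠ 0 := by
    rw [(hmon.map φ).leadingCoeff, map_one]; exact one_ne_zero
  have key : (h₁.map φ₁).map ι = ((h.map φ).scaleRoots (φ c)⁻¹).map ι := by
    rw [map_map, hιφ₁, hmap, map_scaleRoots _ _ _ hlead, map_map, hιφ, map_inv₀, hφ c]
  rw [map_injective ι ι.injective key, irreducible_scaleRoots_iff _ (inv_ne_zero hφc)]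

/-- `K(x₁) = K(x)` for `x₁ = c⁻¹x` with `c` a nonzero element of `K`: in particular `L = K(x₁)`
iff `L = K(x)`. [folklore] -/
theorem adjoin_inv_mul_eq {K : Type*} [Field K] [Algebra K L] {d : L}
    (hd : d ∈ Set.range (algebraMap K L)) (hd0 : d ≠ 0) (x : L) :
    Algebra.adjoin K ({d⁻¹ * x} : Set L) = Algebra.adjoin K ({x} : Set L) := by
  obtain ⟨k, rfl⟩ := hd
  have hk0 : k ≠ 0 := fun h0 => hd0 (by rw [h0, map_zero])
  apply le_antisymm
  · refine Algebra.adjoin_le (Set.singleton_subset_iff.mpr ?_)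
    rw [← map_inv₀, ← Algebra.smul_def]
    exact Subalgebra.smul_mem _ (Algebra.self_mem_adjoin_singleton K x) _
  · refine Algebra.adjoin_le (Set.singleton_subset_iff.mpr ?_)
    have hx : x = k • ((algebraMap K L k)⁻¹ * x) := by
      rw [Algebra.smul_def, ← mul_assoc, mul_inv_cancel₀ ((_root_.map_ne_zero _).mpr hk0),
        one_mul]
    have hmem : k • ((algebraMap K L k)⁻¹ * x) ∈
        Algebra.adjoin K ({(algebraMap K L k)⁻¹ * x} : Set L) :=
      Subalgebra.smul_mem _ (Algebra.self_mem_adjoin_singleton K _) _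
    rw [← hx] at hmem
    exact hmem

end Transform

/-! ## The chart of the centre of `μ`: the quadratic transform `R₁` of `R` along `O` -/

section Chart

variable {L : Type u} [Field L] (O : ValuationSubring L) {R : Subring L}

/-- **A generator of minimal value.** For a Noetherian local subring `R ⊆ O` with `𝔪_R ≠ 0`
there is a nonzero `c ∈ 𝔪_R` with `μ(y) ≥ μ(c)` for all `y ∈ 𝔪_R` (a member of minimal value
of a finite generating set — the chart `u_{j₀} ≠ 0` of the blowing up of `Spec R` at `𝔪_R`
which contains the centre of `μ`; `u_{j₀}` "is a local equation of `π₀⁻¹(W)`").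
[cite: CossartPiltant2019, proof of Prop. 2.7 (arXiv v1, p. 14)] -/
theorem exists_max_valuation_maximalIdeal [IsLocalRing R] [IsNoetherianRing R]
    (hRO : R ≤ O.toSubring) (hm : maximalIdeal R ≠ ⊥) :
    ∃ c : R, c ∈ maximalIdeal R ∧ (c : L) ≠ 0 ∧
      ∀ y ∈ maximalIdeal R, O.valuation (y : L) ≤ O.valuation (c : L) := by
  classical
  obtain ⟨u, hu⟩ := (isNoetherianRing_iff_ideal_fg R).mp ‹_› (maximalIdeal R)
  have hne : ∃ y ∈ u, ((y : R) : L) ≠ 0 := by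
    by_contra! hcon
    apply hm
    rw [← hu, Ideal.span_eq_bot]
    intro y hy
    exact Subtype.ext (hcon y hy)
  obtain ⟨c, hcu, hc0, hmax⟩ := exists_max_valuation O u (fun y : R => (y : L)) hne
  refine ⟨c, hu ▸ Ideal.subset_span hcu, hc0, fun y hy => ?_⟩
  rw [← hu] at hy
  induction hy using Submodule.span_induction with
  | mem y hy => exact hmax y hy
  | zero => simp
  | add y z _ _ hy hz =>
    rw [Subring.coe_add]
    exact (Valuation.map_add _ _ _).trans (max_le hy hz)
  | smul a y _ hy =>
    rw [smul_eq_mul, Subring.coe_mul, map_mul]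
    calc O.valuation (a : L) * O.valuation (y : L) ≤ 1 * O.valuation (c : L) :=
          mul_le_mul' ((O.valuation_le_one_iff _).mpr (hRO a.2)) hy
      _ = O.valuation (c : L) := one_mul _

/-- **The chart of the centre of `μ` is the quadratic transform along `O`.** For a Noetherian
local subring `R ⊆ O` and a nonzero `c ∈ 𝔪_R` of minimal value, the local ring
`R₁ = (R[𝔪_R/c])_{𝔪_O ∩ R[𝔪_R/c]}` — the local ring `S' = 𝒪_{𝒮',s'}` of the blown-up base at
the centre `s'` of `μ` — is the quadratic transform of `R` along `O`
(`IsQuadraticTransformAlong`, `QuadraticTransforms.lean`).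
[cite: CossartPiltant2019, Prop. 2.7 (arXiv v1, p. 14)] -/
theorem isQuadraticTransformAlong_of_max [IsLocalRing R] [IsNoetherianRing R]
    (hRO : R ≤ O.toSubring) {c : R} (hcm : c ∈ maximalIdeal R) (hc0 : (c : L) ≠ 0)
    (hmax : ∀ y ∈ maximalIdeal R, O.valuation (y : L) ≤ O.valuation (c : L)) :
    IsQuadraticTransformAlong O R (locAtCentre (blowupRing R (c : L)) O) := by
  classical
  obtain ⟨u, hu⟩ := (isNoetherianRing_iff_ideal_fg R).mp ‹_› (maximalIdeal R)
  have hspan : Ideal.span (↑(insert c u) : Set R) = maximalIdeal R := by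
    rw [Finset.coe_insert, Ideal.span_insert, hu, sup_eq_right]
    exact (Ideal.span_singleton_le_iff_mem _).mpr hcm
  refine ⟨‹_›, hRO, insert c u, c, hspan, Finset.mem_insert_self c u,
    fun h0 => hc0 (by rw [h0]; rfl), fun y hy => hmax y ?_, ?_⟩
  · rw [← hspan]
    exact Ideal.subset_span hy
  · rw [blowupRing_eq_closure_of_span_eq (c : L) _ hspan]

/-- A ring endomorphism of `L` fixing `R` pointwise fixes the chart ring `R[𝔪_R/c]` pointwise
(`σ(y/c) = σ(y)/σ(c)`). [folklore] -/
theorem ringHom_apply_eq_self_of_mem_blowupRing [IsLocalRing R] (σ : L →+* L)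
    (hσ : ∀ r : R, σ r = r) (c : R) {z : L} (hz : z ∈ blowupRing R (c : L)) : σ z = z := by
  have hle : blowupRing R (c : L) ≤ (σ.eqLocus (RingHom.id L)) := by
    refine Subring.closure_le.mpr ?_
    rintro y (hy | ⟨y, -, rfl⟩)
    · exact hσ ⟨y, hy⟩
    · change σ ((y : L) / c) = (y : L) / c
      rw [map_div₀, hσ y, hσ c]
  exact hle hz

/-- Hence it fixes the quadratic transform `(R[𝔪_R/c])_{𝔪_O ∩ R[𝔪_R/c]}` pointwise: the new
base `S'` lies in the fraction field `K` of `S`, on which `G = Aut_K(L)` acts trivially.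
[cite: CossartPiltant2019, Prop. 2.10 (arXiv v1, p. 15)] -/
theorem ringHom_apply_eq_self_of_mem_locAtCentre_blowupRing [IsLocalRing R] (σ : L →+* L)
    (hσ : ∀ r : R, σ r = r) (c : R) {z : L}
    (hz : z ∈ locAtCentre (blowupRing R (c : L)) O) : σ z = z := by
  obtain ⟨a, ha, b, hb, -, rfl⟩ := hz
  rw [map_div₀, ringHom_apply_eq_self_of_mem_blowupRing σ hσ c ha,
    ringHom_apply_eq_self_of_mem_blowupRing σ hσ c hb]

/-- **Residue characteristic is preserved under domination.** If the local subring `R₁`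
dominates the local subring `R` (`R ≤ R₁`, `𝔪_{R₁} ∩ R = 𝔪_R`) then the residue field of `R₁`
has the characteristic of that of `R` (the inclusion is a local homomorphism, so it induces
an embedding of residue fields). [folklore] -/
theorem charP_residueField_of_subringDominates {R₁ : Subring L} [IsLocalRing R]
    [IsLocalRing R₁] (h : SubringDominates R R₁) (p : ℕ) [hp : CharP (ResidueField R) p] :
    CharP (ResidueField R₁) p := by
  let f : R →+* R₁ := Subring.inclusion h.1
  haveI : IsLocalHom f := by
    refine ⟨fun a ha => ?_⟩
    rw [isUnit_subring_iff_inv_mem] at ha ⊢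
    exact ⟨ha.1, h.2 _ a.2 ha.2⟩
  exact (RingHom.charP_iff_charP (ResidueField.map f) p).mp hp

/-- **The new base is excellent.** For a subring `R ⊆ L`, a finite `t ⊆ L` and the subring
`B = R[t]`: if `R` is excellent then so is the ring `B_{𝔪_O ∩ B}` (a local ring once `B ⊆ O`)
(essentially of finite type over `R`; Matsumura §32 p. 260, `ExcellentRingsEssFiniteType.lean`)
— the excellence hypothesis of the local theorem for the base `S' = 𝒪_{𝒮',s'}` of the next
step. [cite: Matsumura1987, §32 p. 260] -/
theorem isExcellentRing_locAtCentre_closure (t : Finset L) (hR : IsExcellentRing R) :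
    IsExcellentRing (locAtCentre (Subring.closure ((R : Set L) ∪ ↑t)) O) := by
  classical
  set B := Subring.closure ((R : Set L) ∪ ↑t) with hB
  set R₁ := locAtCentre B O with hR₁
  have hRB : R ≤ B := fun y hy => Subring.subset_closure (Or.inl hy)
  have hBR₁ : B ≤ R₁ := le_locAtCentre B O
  have hRR₁ : R ≤ R₁ := hRB.trans hBR₁
  letI : Algebra R R₁ := (Subring.inclusion hRR₁).toAlgebra
  have halg : ∀ r : R, ((algebraMap R R₁ r : R₁) : L) = r := fun _ => rfl
  -- the generators, as elements of `R₁`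
  have htR₁ : ∀ y ∈ t, y ∈ R₁ := fun y hy => hBR₁ (Subring.subset_closure (Or.inr hy))
  let s : Finset R₁ := t.attach.image fun y => ⟨y.1, htR₁ y.1 y.2⟩
  -- `B` lies in `R[s] ⊆ R₁`
  have hBadj : ∀ {z : L} (hz : z ∈ B), (⟨z, hBR₁ hz⟩ : R₁) ∈ Algebra.adjoin R (s : Set R₁) := by
    intro z hz
    induction hz using Subring.closure_induction with
    | mem y hy =>
      rcases hy with hy | hy
      · have : (⟨y, hBR₁ (Subring.subset_closure (Or.inl hy))⟩ : R₁) = algebraMap R R₁ ⟨y, hy⟩ :=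
          Subtype.ext rfl
        rw [this]
        exact Subalgebra.algebraMap_mem _ _
      · refine Algebra.subset_adjoin ?_
        rw [Finset.mem_coe, Finset.mem_image]
        exact ⟨⟨y, hy⟩, Finset.mem_attach _ _, rfl⟩
    | zero => exact Subalgebra.zero_mem (Algebra.adjoin R (s : Set R₁))
    | one => exact Subalgebra.one_mem (Algebra.adjoin R (s : Set R₁))
    | add y z hy hz hy' hz' => exact Subalgebra.add_mem _ hy' hz'
    | neg y hy hy' => exact Subalgebra.neg_mem _ hy'
    | mul y z hy hz hy' hz' => exact Subalgebra.mul_mem _ hy' hz'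
  haveI : Algebra.EssFiniteType R R₁ := by
    rw [Algebra.essFiniteType_iff]
    refine ⟨s, fun z => ?_⟩
    obtain ⟨a, ha, b, hb, hvb, hz⟩ := (mem_locAtCentre_iff).mp z.2
    have hb0 : b ≠ 0 := ne_zero_of_valuation_eq_one hvb
    refine ⟨⟨b, hBR₁ hb⟩, hBadj hb, ?_, ?_⟩
    · refine isUnit_iff_exists_inv.mpr ⟨⟨b⁻¹, inv_mem_locAtCentre (hBR₁ hb) hvb⟩, ?_⟩
      exact Subtype.ext (mul_inv_cancel₀ hb0)
    · have : z * ⟨b, hBR₁ hb⟩ = ⟨a, hBR₁ ha⟩ := by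
        apply Subtype.ext
        change (z : L) * b = a
        rw [hz, div_mul_cancel₀ _ hb0]
      rw [this]
      exact hBadj ha
  exact hR.of_essFiniteType ‹_›

end Chart

/-! ## Assumption (G) is preserved (Prop. 2.10) -/

section Stability

variable {L : Type u} [Field L] {R : Subring L} [IsLocalRing R]

/-- If `σx = r(x)` is a root of `h` with `h ≡ X^m mod 𝔪_R[X]`, `m ≥ 1`, `deg r < m`, and `(h)` is
the kernel of `g ↦ g(x)` on `R[X]`, then `r(0) ∈ 𝔪_R`: from `h ∣ h ∘ r`, reducing modulo `𝔪_R`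
gives `X^m ∣ r̄^m` in `k[X]`, so `X ∣ r̄`. [folklore] -/
theorem coeff_zero_mem_maximalIdeal_of_aeval_comp_eq_zero {h : R[X]} (hmon : h.Monic)
    (hm : 0 < h.natDegree) (hcoef : ∀ i < h.natDegree, h.coeff i ∈ maximalIdeal R) {x : L}
    (hdvd : ∀ g : R[X], aeval x g = 0 → h ∣ g) {r : R[X]} (hr : aeval (aeval x r) h = 0) :
    r.coeff 0 ∈ maximalIdeal R := by
  -- `h ∣ h.comp r`
  have hcomp : aeval x (h.comp r) = 0 := by rw [aeval_comp, hr]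
  obtain ⟨q, hq⟩ := hdvd _ hcomp
  -- reduce modulo `𝔪_R`: `h̄ = X^m`
  set k := ResidueField R
  have hbar : h.map (residue R) = X ^ h.natDegree := by
    refine Polynomial.ext fun i => ?_
    rw [coeff_map, coeff_X_pow]
    rcases lt_trichotomy i h.natDegree with hlt | heq | hgt
    · rw [if_neg hlt.ne, (residue_eq_zero_iff _).mpr (hcoef i hlt)]
    · rw [if_pos heq, heq, show h.coeff h.natDegree = 1 from hmon, map_one]
    · rw [if_neg hgt.ne', coeff_eq_zero_of_natDegree_lt hgt, map_zero]
  have hdiv : (X : k[X]) ^ h.natDegree ∣ (r.map (residue R)) ^ h.natDegree := by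
    have h1 := congrArg (Polynomial.map (residue R)) hq
    rw [map_comp, Polynomial.map_mul, hbar, X_pow_comp] at h1
    exact ⟨q.map (residue R), h1⟩
  have hX : (X : k[X]) ∣ r.map (residue R) := by
    have h2 : (X : k[X]) ∣ (r.map (residue R)) ^ h.natDegree :=
      (dvd_pow_self X hm.ne').trans hdiv
    exact prime_X.dvd_of_dvd_pow h2
  have h0 : (r.map (residue R)).coeff 0 = 0 := by
    obtain ⟨w, hw⟩ := hX
    rw [hw, coeff_X_mul_zero]
  rw [coeff_map] at h0
  exact (residue_eq_zero_iff _).mp h0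

/-- **Assumption (G) is preserved** (Cossart–Piltant, Prop. 2.10: "for every `s' ∈ σ⁻¹(s)`,
`𝒳'_{s'}` satisfies again (G)"; here for the centre the closed point). Let `R ⊆ L` be a local
subring, `h ∈ R[X]` monic of degree `m ≥ 1` with `h ≡ X^m mod 𝔪_R[X]` and root `x ∈ L` such
that `(h)` is the kernel of `R[X] → L`, `g ↦ g(x)` (e.g. `h` irreducible over the fraction
field, `ArithmeticalThreefoldsLocalProofs.lean`); let `c ∈ R` be nonzero and `R₁ ⊆ L` a subring
containing `R` and the `y/c`, `y ∈ 𝔪_R` (e.g. the quadratic transform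
`(R[𝔪_R/c])_{𝔪_O ∩ R[𝔪_R/c]}`). If a ring endomorphism `σ` of `L` fixes `R₁` pointwise and maps
`R[x]` into itself ("`𝒳` is `G`-invariant"), then `σ` maps `R₁[x₁]`, `x₁ = c⁻¹x`, into itself:
`σx = r(x)` with `deg r < m` and `r(0) ∈ 𝔪_R`
(`coeff_zero_mem_maximalIdeal_of_aeval_comp_eq_zero`), so
`σx₁ = r(0)/c + Σ_{k ≥ 1} r_k c^{k-1} x₁^k ∈ R₁[x₁]`.
[cite: CossartPiltant2019, Prop. 2.10 (arXiv v1, p. 15)] -/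
theorem adjoin_transform_stable_of_stable {h : R[X]} (hmon : h.Monic) (hm : 0 < h.natDegree)
    (hcoef : ∀ i < h.natDegree, h.coeff i ∈ maximalIdeal R) {x : L} (hx : aeval x h = 0)
    (hdvd : ∀ g : R[X], aeval x g = 0 → h ∣ g) {c : R} (hc0 : (c : L) ≠ 0) {R₁ : Subring L}
    (hRR₁ : R ≤ R₁) (hcR₁ : ∀ y ∈ maximalIdeal R, (y : L) / c ∈ R₁) (σ : L →+* L)
    (hσR₁ : ∀ r : R₁, σ r = r)
    (hσ : ∀ y ∈ Algebra.adjoin R ({x} : Set L), σ y ∈ Algebra.adjoin R ({x} : Set L)) :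
    ∀ y ∈ Algebra.adjoin R₁ ({(c : L)⁻¹ * x} : Set L),
      σ y ∈ Algebra.adjoin R₁ ({(c : L)⁻¹ * x} : Set L) := by
  set x₁ : L := (c : L)⁻¹ * x with hx₁
  set A₁ := Algebra.adjoin R₁ ({x₁} : Set L) with hA₁
  have hσR : ∀ r : R, σ r = r := fun r => hσR₁ ⟨r, hRR₁ r.2⟩
  have hh1 : h ≠ 1 := fun h1 => by rw [h1, natDegree_one] at hm; exact lt_irrefl 0 hm
  -- `σ x = r(x)` with `deg r < m`
  have hσx : σ x ∈ Algebra.adjoin R ({x} : Set L) := hσ x (Algebra.self_mem_adjoin_singleton R x)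
  rw [Algebra.adjoin_singleton_eq_range_aeval] at hσx
  obtain ⟨g, hg⟩ := hσx
  have hg' : aeval x g = σ x := hg
  set r := g %ₘ h with hr
  have hrx : aeval x r = σ x := by
    have e := congrArg (aeval x) (modByMonic_add_div g h)
    rw [map_add, map_mul, hx, zero_mul, add_zero] at e
    rw [hr, e, hg']
  have hrdeg : r.natDegree < h.natDegree := natDegree_modByMonic_lt g hmon hh1
  -- `σ x` is a root of `h`, so `r(0) ∈ 𝔪_R`
  have hroot : aeval (aeval x r) h = 0 := by
    have e := congrArg σ hx
    rwa [map_zero, aeval_def, hom_eval₂, show σ.comp (algebraMap R L) = algebraMap R L from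
      RingHom.ext fun r => hσR r, ← aeval_def, ← hrx] at e
  have hr0 : r.coeff 0 ∈ maximalIdeal R :=
    coeff_zero_mem_maximalIdeal_of_aeval_comp_eq_zero hmon hm hcoef hdvd hroot
  -- `σ x₁ = c⁻¹ r(x) ∈ R₁[x₁]`
  have hxc : x = (c : L) * x₁ := by rw [hx₁, ← mul_assoc, mul_inv_cancel₀ hc0, one_mul]
  have hσx₁ : σ x₁ ∈ A₁ := by
    have e1 : σ x₁ = (c : L)⁻¹ * aeval x r := by
      rw [hx₁, map_mul, map_inv₀, hσR c, hrx]
    rw [e1, aeval_eq_sum_range' hrdeg, Finset.mul_sum]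
    refine Subalgebra.sum_mem _ fun k hk => ?_
    rw [Algebra.smul_def, hxc, mul_pow, ← mul_assoc, ← mul_assoc]
    refine Subalgebra.mul_mem _ ?_ (Subalgebra.pow_mem _ (Algebra.self_mem_adjoin_singleton R₁ x₁) _)
    rcases Nat.eq_zero_or_pos k with hk0 | hkpos
    · -- `k = 0`: `c⁻¹ r(0) ∈ R₁`
      rw [hk0, pow_zero, mul_one]
      have : (c : L)⁻¹ * algebraMap R L (r.coeff 0) = ((r.coeff 0 : R) : L) / c := by
        rw [div_eq_mul_inv, mul_comm]; rfl
      rw [this]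
      exact Subalgebra.algebraMap_mem A₁ (⟨_, hcR₁ _ hr0⟩ : R₁)
    · -- `k = j + 1 ≥ 1`: `c⁻¹ r_k c^k = r_k c^j ∈ R ⊆ R₁`
      obtain ⟨j, rfl⟩ : ∃ j, k = j + 1 := ⟨k - 1, (Nat.sub_add_cancel hkpos).symm⟩
      have : (c : L)⁻¹ * algebraMap R L (r.coeff (j + 1)) * (c : L) ^ (j + 1) =
          ((r.coeff (j + 1) * c ^ j : R) : L) := by
        change (c : L)⁻¹ * ((r.coeff (j + 1) : R) : L) * (c : L) ^ (j + 1) = _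
        rw [Subring.coe_mul, Subring.coe_pow]
        field_simp
        ring
      rw [this]
      exact Subalgebra.algebraMap_mem A₁ (⟨_, hRR₁ (r.coeff (j + 1) * c ^ j).2⟩ : R₁)
  -- conclude by induction over `R₁[x₁]`
  intro y hy
  induction hy using Algebra.adjoin_induction with
  | mem y hy =>
    rw [Set.mem_singleton_iff] at hy
    rw [hy]
    exact hσx₁
  | algebraMap r =>
    change σ (r : L) ∈ A₁
    rw [hσR₁ r]
    exact Subalgebra.algebraMap_mem A₁ r
  | add y z _ _ hy hz => rw [map_add]; exact Subalgebra.add_mem _ hy hz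
  | mul y z _ _ hy hz => rw [map_mul]; exact Subalgebra.mul_mem _ hy hz

end Stability

/-! ## Back to the original base: models over `R₁` are models over `R` -/

section Descent

variable {L : Type u} [Field L] (O : ValuationSubring L) {R : Subring L}

/-- Regularity of the localization only depends on the prime ideal (transport along an equality
of ideals; the two primality instances are irrelevant). Local copy of the transport lemma of
`JacobianRegularLocus.lean`, kept private to avoid that import. [folklore] -/
private theorem isRegularLocalRing_atPrime_congr {A : Type*} [CommRing A] {I J : Ideal A}
    [I.IsPrime] [J.IsPrime] (e : I = J) :
    IsRegularLocalRing (Localization.AtPrime I) ↔ IsRegularLocalRing (Localization.AtPrime J) := by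
  subst e
  exact Iff.rfl

/-- **The weak local-uniformization conclusion descends along a local blowing up.** Let
`R ⊆ O` be a subring of `L` and `R₁ = (R[b])_{𝔪_O ∩ R[b]}` a local blowing up of `R` with
respect to `O` (`IsLocalBlowup`, `LocalBlowup.lean`; e.g. the quadratic transform along `O`).
If for `x₁ ∈ L` and a finite `t₁ ⊆ L` the model `R₁[x₁][t₁] ⊆ O` is regular at the centre
`𝔪_O ∩ R₁[x₁][t₁]`, and `x ∈ R₁[x₁][t₁]` (e.g. `x = c·x₁`), then for some finite `t ⊆ L` the
model `R[x][t] ⊆ O` is regular at its centre — namely `t = b ∪ {x₁} ∪ t₁`, for which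
`R[x][t] ⊆ R₁[x₁][t₁] ⊆ R[x][t]_{𝔪_O ∩ R[x][t]}` (denominators of `R₁` are `v`-units of
`R[b]`), so the two local rings coincide (`ModelTransport.lean`). This turns the conclusion of
the local theorem at the new frame `(S', h', x')` back into its conclusion at `(S, h, x)`:
"a composition of local Hironaka-permissible blowing ups" is again one.
[cite: CossartPiltant2019, Thm. 1.4 and §2.2 (arXiv v1, pp. 4, 14)] -/
theorem exists_model_of_isLocalBlowup_model {R₁ : Subring L} (hq : IsLocalBlowup O R R₁)
    {x x₁ : L} {t₁ : Finset L}
    (ht₁ : (Algebra.adjoin R₁ (insert x₁ (t₁ : Set L))).toSubring ≤ O.toSubring)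
    (hreg : IsRegularLocalRing (Localization.AtPrime
      (Ideal.comap (Subring.inclusion ht₁) (maximalIdeal O))))
    (hx : x ∈ Algebra.adjoin R₁ (insert x₁ (t₁ : Set L))) :
    ∃ (t : Finset L) (ht : (Algebra.adjoin R (insert x (t : Set L))).toSubring ≤ O.toSubring),
      IsRegularLocalRing (Localization.AtPrime
        (Ideal.comap (Subring.inclusion ht) (maximalIdeal O))) := by
  classical
  obtain ⟨hRO, b, hbO, rfl⟩ := hq
  set B := Subring.closure ((R : Set L) ∪ ↑b) with hB
  set R₁ := locAtCentre B O with hR₁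
  have hBO : B ≤ O.toSubring := Subring.closure_le.mpr (Set.union_subset hRO hbO)
  have hBR₁ : B ≤ R₁ := le_locAtCentre B O
  have hR₁O : R₁ ≤ O.toSubring := locAtCentre_le hBO
  set T₁ := Algebra.adjoin R₁ (insert x₁ (t₁ : Set L)) with hT₁
  -- the model over `R`
  let t : Finset L := b ∪ insert x₁ t₁
  set T := Algebra.adjoin R (insert x (t : Set L)) with hT
  -- `T ⊆ T₁`
  have hTT₁ : T.toSubring ≤ T₁.toSubring := by
    rw [Algebra.adjoin_eq_ring_closure]
    refine Subring.closure_le.mpr ?_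
    rintro y (⟨r, rfl⟩ | hy)
    · exact Subalgebra.algebraMap_mem T₁ (⟨_, hBR₁ (Subring.subset_closure (Or.inl r.2))⟩ : R₁)
    · rcases Set.mem_insert_iff.mp hy with rfl | hy
      · exact hx
      · rcases Finset.mem_union.mp (Finset.mem_coe.mp hy) with hy | hy
        · exact Subalgebra.algebraMap_mem T₁
            (⟨y, hBR₁ (Subring.subset_closure (Or.inr hy))⟩ : R₁)
        · refine Algebra.subset_adjoin ?_
          rcases Finset.mem_insert.mp hy with rfl | hy
          exacts [Set.mem_insert _ _, Set.mem_insert_of_mem _ (Finset.mem_coe.mpr hy)]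
  have hTO : T.toSubring ≤ O.toSubring := hTT₁.trans ht₁
  refine ⟨t, hTO, ?_⟩
  -- `B ⊆ T`
  have hBT : B ≤ T.toSubring := by
    rw [Algebra.adjoin_eq_ring_closure]
    refine Subring.closure_mono ?_
    rintro y (hy | hy)
    · exact Or.inl ⟨⟨y, hy⟩, rfl⟩
    · refine Or.inr (Set.mem_insert_of_mem _ ?_)
      simp [t, hy]
  -- sandwich: every element of `T₁` is `a/s` with `a, s ∈ T`, `v(s) = 1`
  have H : ∀ z ∈ T₁, ∃ a ∈ T.toSubring, ∃ s ∈ T.toSubring, O.valuation s = 1 ∧ z * s = a := by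
    intro z hz
    induction hz using Algebra.adjoin_induction with
    | mem y hy =>
      refine ⟨y, ?_, 1, Subring.one_mem _, by simp, by simp⟩
      rcases Set.mem_insert_iff.mp hy with rfl | hy
      · exact Algebra.subset_adjoin (Set.mem_insert_of_mem _ (by simp [t]))
      · exact Algebra.subset_adjoin (Set.mem_insert_of_mem _ (by simp [t, hy]))
    | algebraMap r =>
      obtain ⟨a, ha, s, hs, hvs, hr⟩ := (mem_locAtCentre_iff).mp r.2
      refine ⟨a, hBT ha, s, hBT hs, hvs, ?_⟩
      change (r : L) * s = a
      rw [hr, div_mul_cancel₀ _ (ne_zero_of_valuation_eq_one hvs)]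
    | add y z _ _ hy hz =>
      obtain ⟨a, ha, s, hs, hvs, hys⟩ := hy
      obtain ⟨a', ha', s', hs', hvs', hzs⟩ := hz
      refine ⟨a * s' + a' * s, Subring.add_mem _ (Subring.mul_mem _ ha hs')
        (Subring.mul_mem _ ha' hs), s * s', Subring.mul_mem _ hs hs', by rw [map_mul, hvs, hvs', mul_one], ?_⟩
      rw [← hys, ← hzs]; ring
    | mul y z _ _ hy hz =>
      obtain ⟨a, ha, s, hs, hvs, hys⟩ := hy
      obtain ⟨a', ha', s', hs', hvs', hzs⟩ := hz
      refine ⟨a * a', Subring.mul_mem _ ha ha', s * s', Subring.mul_mem _ hs hs',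
        by rw [map_mul, hvs, hvs', mul_one], ?_⟩
      rw [← hys, ← hzs]; ring
  -- apply the abstract sandwich
  let f : T.toSubring →+* T₁.toSubring := Subring.inclusion hTT₁
  have hinj : Function.Injective f := Subring.inclusion_injective hTT₁
  set P : Ideal T₁.toSubring := Ideal.comap (Subring.inclusion ht₁) (maximalIdeal O) with hP
  haveI : P.IsPrime := Ideal.IsPrime.comap _
  have hPmem : ∀ z : T₁.toSubring, z ∈ P ↔ O.valuation (z : L) < 1 := fun z => by
    rw [hP, Ideal.mem_comap, ValuationSubring.valuation_lt_one_iff]; rfl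
  have H' : ∀ z : T₁.toSubring, ∃ a s : T.toSubring, f s ∉ P ∧ z * f s = f a := by
    intro z
    obtain ⟨a, ha, s, hs, hvs, hzs⟩ := H z z.2
    refine ⟨⟨a, ha⟩, ⟨s, hs⟩, ?_, Subtype.ext hzs⟩
    rw [hPmem]
    change ¬ O.valuation s < 1
    rw [hvs]; exact lt_irrefl 1
  have key := (isRegularLocalRing_localization_comap_iff_of_sandwich f hinj P H').mpr hreg
  have hcomap : P.comap f = Ideal.comap (Subring.inclusion hTO) (maximalIdeal O) := by
    rw [hP, Ideal.comap_comap]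
    rfl
  exact (isRegularLocalRing_atPrime_congr hcomap).mp key

/-- **The weak local-uniformization conclusion descends along the quadratic transform** with
`x = c·x₁`: the form used for the first blowing up of Cossart–Piltant's local theorem in normal
form (`x₁ = x/u_{j₀}`). [cite: CossartPiltant2019, Thm. 1.4 and Prop. 2.7 (arXiv v1, pp. 4, 14)] -/
theorem exists_model_of_quadraticTransform_model [IsLocalRing R] {R₁ : Subring L}
    (hq : IsQuadraticTransformAlong O R R₁) {c : R} (hc0 : (c : L) ≠ 0) {x : L} {t₁ : Finset L}
    (ht₁ : (Algebra.adjoin R₁ (insert ((c : L)⁻¹ * x) (t₁ : Set L))).toSubring ≤ O.toSubring)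
    (hreg : IsRegularLocalRing (Localization.AtPrime
      (Ideal.comap (Subring.inclusion ht₁) (maximalIdeal O)))) :
    ∃ (t : Finset L) (ht : (Algebra.adjoin R (insert x (t : Set L))).toSubring ≤ O.toSubring),
      IsRegularLocalRing (Localization.AtPrime
        (Ideal.comap (Subring.inclusion ht) (maximalIdeal O))) := by
  refine exists_model_of_isLocalBlowup_model O hq.isLocalBlowup ht₁ hreg ?_
  have hmem : (c : L) * ((c : L)⁻¹ * x) ∈
      Algebra.adjoin R₁ (insert ((c : L)⁻¹ * x) (t₁ : Set L)) :=
    Subalgebra.mul_mem _ (Subalgebra.algebraMap_mem _ (⟨c, hq.le c.2⟩ : R₁))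
      (Algebra.subset_adjoin (Set.mem_insert _ _))
  rwa [← mul_assoc, mul_inv_cancel₀ hc0, one_mul] at hmem

end Descent

end Literature.AlgebraicGeometry.Resolution

end
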